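import Mathlib
import Literature.NumberTheory.LFunctions.Zhang2022.SkeletonPartOneB
import Literature.NumberTheory.LFunctions.Zhang2022.SkeletonAssembly
import HarnessLib

/-!
# Zhang (2022) §5, Lemma 5.2: the skeleton leaf `Lemma52 c′` DISCHARGED (node Z22:Lem5.2)

Topic `Literature/NumberTheory/LFunctions/Zhang2022` (Landau–Siegel adjudication tree;
verdict-neutral). Y. Zhang, *Discrete mean estimates and the Landau–Siegel zero*,
arXiv:2211.02515v1 (2022) [Zhang2022LandauSiegel], §5, Lemma 5.2 (PDF pp. 24–25, tex L1349–1371),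
DAG node `Z22:Lem5.2` (+ its proof block `Z22:Lem5.2.pf`):

> **Lemma 5.2.** Let `ψ` and `s` be as in Lemma 5.1 [`ψ ∈ Ψ`, `|σ − 1/2| ≤ α`,
> `|t − 2πt₀| < 𝓛₁ + 2`]. Then
> `Y(s+β₁,ψ)Y(s+β₂,ψ)Y(s+β₃,ψ)/Y(s,ψ) = (pt₀)^{β₃}Z(s,ψ)⁻¹(1 + O(𝓛⁻¹²³))`.
> *Proof.* The left side is `Z(s,ψ)⁻¹∏_{1≤j≤3}(Y(s+β_j,ψ)/Y(s,ψ))`. By (2.6) and the Stirling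
> formula, for `|w| < 5α`, `(Y′/Y)(s+w,ψ) = −½(Z′/Z)(s+w,ψ) = ½log(pt₀) + O(𝓛⁻¹¹⁴)`. Hence, for
> `1 ≤ j ≤ 3`, `Y(s+β_j,ψ)/Y(s,ψ) = exp(∫₀^{β_j}(Y′/Y)(s+w,ψ)dw) = (pt₀)^{β_j/2}(1 + O(𝓛⁻¹²³))`.
> The result now follows since `(β₁+β₂+β₃)/2 = β₃`. □

The typed skeleton states this as the CLAIM node `Skeleton.Lemma52 c′` (`SkeletonPartOneB.lean`;
the leaf `h52` of the whole-DAG theorem `Skeleton.theorem1_of_leaves`), in the relative-error form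
`‖LHS − (pt₀)^{β₃}Z(s,ψ)⁻¹‖ ≤ C𝓛⁻¹²³‖(pt₀)^{β₃}Z(s,ψ)⁻¹‖` for all large `D`, with the shifts
`β₁ = iα(1−5c′α𝓛)`, `β₂ = 2iα(1+c′α𝓛)`, `β₃ = 3iα(1−c′α𝓛)` of (2.13) and `Y = Skeleton.Yroot`
(an analytic square root of `Z(·,ψ)⁻¹` on the upper half-plane, `Skeleton.Yroot_spec`).

The tree already PROVES the proof's content exactly, for a primitive character to any modulus and
any analytic square root `Y` of `Z⁻¹` (`GammaFactor.sqrt_inv_Zfac_triple_shift`,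
`Section2AnalyticRootY.lean`):
`Y(s+iv₁)Y(s+iv₂)Y(s+iv₃)/Y(s) = Z(s,θ)⁻¹·e^{i(v₁+v₂+v₃)log(pt/2π)/2}·e^{η}`,
`‖η‖ ≤ Σ_j(2|v_j|+4A+10)|v_j|/(2t)` (`0 < σ ≤ A`, `t ≥ 4A`, `|v_j| ≤ t/2`).
This file supplies the manuscript's parameter bookkeeping and concludes
`Skeleton.lemma52_holds : ∀ c′, Lemma52 c′` with the absolute constant `C = 240`
(for `𝓛 ≥ max(3, π|c′|)`): `v₁+v₂+v₃ = 2v₃`; `|v_j| ≤ 6α` once `|c′|α𝓛 ≤ 1`;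
`log(pt/2π) − log(pt₀) = log(1+u)` with `|u| ≤ (𝓛₁+2)/(2πt₀)`, so
`|v₃|·|log(1+u)| ≤ 6α𝓛₁𝓛⁻⁵¹⁹`; `‖η‖ ≤ 30α𝓛⁻⁵¹⁹` (`t ≥ 5t₀`); in total the exponent `ζ` with
`LHS = (pt₀)^{β₃}Z⁻¹e^{ζ}` has `‖ζ‖ ≤ 36α𝓛₁t₀⁻¹ = 36π𝓛⁻¹²³ ≤ 120𝓛⁻¹²³ ≤ 1` and
`‖e^{ζ} − 1‖ ≤ 2‖ζ‖` (`α = π𝓛⁻⁹`, `𝓛₁ = 𝓛⁴⁰⁵`, `t₀ = 𝓛⁵¹⁹`: `9 − 405 + 519 = 123`, the printed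
exponent).

No new definitions, no named facts, no `sorry`; nothing here bears on Theorems 1–2 of the source
or on Landau–Siegel zeros (a discharge of ONE manuscript lemma from tree theorems).

## References

* Y. Zhang, arXiv:2211.02515v1 (2022), §5 Lemma 5.2, pp. 24–25; (2.6), (2.8), (2.10), (2.13).
  [cite: Zhang2022LandauSiegel, Lemma 5.2 p.24]
-/

noncomputable section

open Complex Real

namespace Literature.NumberTheory.LFunctions.Zhang2022.Skeleton

/-! ## Parameter bookkeeping -/

/-- `α = π𝓛⁻⁹` ((2.10) with `log P = 𝓛⁹` by (2.6)). [cite: Zhang2022LandauSiegel, §2 (2.10)] -/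
private theorem alpha_eq_pi_div (D : ℕ) : alpha D = π / ell D ^ 9 := by
  rw [alpha, bigP, Real.log_exp]

/-- From `D ≥ ⌈exp L₀⌉` one has `L₀ ≤ 𝓛`. [cite: Zhang2022LandauSiegel, §2 (2.1)] -/
private theorem le_ell_of_ceil_exp_le {L₀ : ℝ} {D : ℕ} (hD : ⌈Real.exp L₀⌉₊ ≤ D) :
    L₀ ≤ ell D := by
  have h : Real.exp L₀ ≤ D := le_trans (Nat.le_ceil _) (by exact_mod_cast hD)
  exact (Real.le_log_iff_exp_le (lt_of_lt_of_le (Real.exp_pos _) h)).mpr h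

/-- `|log(1+u)| ≤ 2|u|` for `|u| ≤ 1/2`. [folklore] -/
private theorem abs_log_one_add_le {u : ℝ} (hu : |u| ≤ 1 / 2) :
    |Real.log (1 + u)| ≤ 2 * |u| := by
  have hlt : |(-u)| < 1 := by rw [abs_neg]; linarith
  have hm := Real.abs_log_sub_add_sum_range_le hlt 0
  simp only [Finset.sum_range_zero, zero_add, sub_neg_eq_add, abs_neg, pow_one] at hm
  have h2u : |u| / (1 - |u|) ≤ 2 * |u| := by
    rw [div_le_iff₀ (by linarith)]
    nlinarith [abs_nonneg u]
  exact hm.trans h2u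

/-! ## Lemma 5.2 -/

/-- **Lemma 5.2 HOLDS** (the node `Skeleton.Lemma52 c′`, for every real `c′`), with implied
constant `C = 240` once `𝓛 ≥ max(3, π|c′|)`: for `ψ ∈ Ψ`, `|σ − 1/2| ≤ α`, `|t − 2πt₀| < 𝓛₁ + 2`,
`‖Y(s+β₁)Y(s+β₂)Y(s+β₃)/Y(s) − (pt₀)^{β₃}Z(s,ψ)⁻¹‖ ≤ 240·𝓛⁻¹²³·‖(pt₀)^{β₃}Z(s,ψ)⁻¹‖` — the
manuscript's proof ("`Y′/Y = −½Z′/Z = ½log(pt₀) + O(𝓛⁻¹¹⁴)`", integrate along `[0, β_j]`,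
`(β₁+β₂+β₃)/2 = β₃`) made exact by the tree's `GammaFactor.sqrt_inv_Zfac_triple_shift`, plus the
bookkeeping `α = π𝓛⁻⁹`, `t = 2πt₀ + O(𝓛₁)`, `t₀ = 𝓛⁵¹⁹`, `𝓛₁ = 𝓛⁴⁰⁵`. DAG node Z22:Lem5.2
[Z22 p.24–25, Lemma 5.2, tex L1349–L1371]. [cite: Zhang2022LandauSiegel, Lemma 5.2 p.24] -/
theorem lemma52_holds (c' : ℝ) : Lemma52 c' := by
  refine ⟨240, ⌈Real.exp (max 3 (π * |c'|))⌉₊, fun D _ χ hD _ _ x s hs => ?_⟩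
  -- the parameters `𝓛`, `α`
  have hL := le_ell_of_ceil_exp_le hD
  have hπ3 : 3 < π := Real.pi_gt_three
  have hπ4 : π < 4 := Real.pi_lt_four
  have hπ0 : 0 < π := Real.pi_pos
  set ℓ : ℝ := ell D with hℓdef
  have hℓ3 : 3 ≤ ℓ := le_trans (le_max_left _ _) hL
  have hℓc : π * |c'| ≤ ℓ := le_trans (le_max_right _ _) hL
  have hℓ0 : 0 < ℓ := by linarith
  have hℓ1 : 1 ≤ ℓ := by linarith
  have hα : alpha D = π / ℓ ^ 9 := alpha_eq_pi_div D
  set α : ℝ := alpha D with hαdef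
  have hα0 : 0 < α := by rw [hα]; positivity
  have hℓ9 : (3 : ℝ) ^ 9 ≤ ℓ ^ 9 := pow_le_pow_left₀ (by norm_num) hℓ3 9
  have hℓ9pos : 0 < ℓ ^ 9 := by positivity
  have hα6 : 6 * α ≤ 1 := by
    rw [hα, mul_div_assoc', div_le_one hℓ9pos]
    norm_num at hℓ9
    linarith
  -- `|c′|α𝓛 ≤ 1`
  have hℓ8 : ℓ ≤ ℓ ^ 8 := le_self_pow₀ hℓ1 (by norm_num)
  have hcαℓ : |c' * α * ℓ| ≤ 1 := by
    rw [abs_mul, abs_mul, abs_of_pos hα0, abs_of_pos hℓ0, hα]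
    have h8 : 0 < ℓ ^ 8 := by positivity
    have : |c'| * (π / ℓ ^ 9) * ℓ = π * |c'| / ℓ ^ 8 := by
      field_simp
    rw [this, div_le_one h8]
    linarith
  obtain ⟨hc1, hc2⟩ := abs_le.mp hcαℓ
  -- the shifts `β_j = iv_j`, `|v_j| ≤ 6α`, `v₁ + v₂ + v₃ = 2v₃`
  set v₁ : ℝ := α * (1 - 5 * (c' * α * ℓ)) with hv₁
  set v₂ : ℝ := 2 * α * (1 + c' * α * ℓ) with hv₂
  set v₃ : ℝ := 3 * α * (1 - c' * α * ℓ) with hv₃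
  have hb1 : beta1 c' D = (v₁ : ℂ) * I := by
    rw [beta1, hv₁]; push_cast; ring
  have hb2 : beta2 c' D = (v₂ : ℂ) * I := by
    rw [beta2, hv₂]; push_cast; ring
  have hb3 : beta3 c' D = (v₃ : ℂ) * I := by
    rw [beta3, hv₃]; push_cast; ring
  have hsum : v₁ + v₂ + v₃ = 2 * v₃ := by
    simp only [hv₁, hv₂, hv₃]; ring
  have habs1 : |v₁| ≤ 6 * α := by
    have h : |1 - 5 * (c' * α * ℓ)| ≤ 6 := abs_le.mpr ⟨by linarith, by linarith⟩
    calc |v₁| = α * |1 - 5 * (c' * α * ℓ)| := by rw [hv₁, abs_mul, abs_of_pos hα0]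
      _ ≤ α * 6 := mul_le_mul_of_nonneg_left h hα0.le
      _ = 6 * α := by ring
  have habs2 : |v₂| ≤ 6 * α := by
    have h : |1 + c' * α * ℓ| ≤ 2 := abs_le.mpr ⟨by linarith, by linarith⟩
    calc |v₂| = 2 * α * |1 + c' * α * ℓ| := by
          rw [hv₂, abs_mul, abs_mul, abs_of_pos hα0, abs_two]
      _ ≤ 2 * α * 2 := mul_le_mul_of_nonneg_left h (by positivity)
      _ ≤ 6 * α := by linarith
  have habs3 : |v₃| ≤ 6 * α := by
    have h : |1 - c' * α * ℓ| ≤ 2 := abs_le.mpr ⟨by linarith, by linarith⟩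
    calc |v₃| = 3 * α * |1 - c' * α * ℓ| := by
          rw [hv₃, abs_mul, abs_mul, abs_of_pos hα0, abs_of_pos (by norm_num : (0:ℝ) < 3)]
      _ ≤ 3 * α * 2 := mul_le_mul_of_nonneg_left h (by positivity)
      _ = 6 * α := by ring
  -- the point `s = σ + it`: `0 < σ ≤ 1`, `t ≥ 5t₀`
  obtain ⟨hσ, hτ⟩ := hs
  set σ : ℝ := s.re with hσdef
  set t : ℝ := s.im with htdef
  have hsre : (σ : ℂ) + t * I = s := Complex.re_add_im s
  obtain ⟨hσ1, hσ2⟩ := abs_le.mp hσ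
  have hσ0 : 0 < σ := by linarith
  have hσA : σ ≤ 1 := by linarith
  have ht0 : t0 D = ℓ ^ 519 := rfl
  have hl1 : ell1 D = ℓ ^ 405 := rfl
  have h405 : 1 ≤ ℓ ^ 405 := one_le_pow₀ hℓ1
  have h114 : (3 : ℝ) ^ 114 ≤ ℓ ^ 114 := pow_le_pow_left₀ (by norm_num) hℓ3 114
  have h114' : 3 ≤ ℓ ^ 114 := le_trans (by norm_num) h114
  have h519 : ℓ ^ 519 = ℓ ^ 405 * ℓ ^ 114 := by rw [← pow_add]
  have hl1t0 : ℓ ^ 405 + 2 ≤ ℓ ^ 519 := by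
    have h : ℓ ^ 405 * 3 ≤ ℓ ^ 405 * ℓ ^ 114 :=
      mul_le_mul_of_nonneg_left h114' (le_trans zero_le_one h405)
    rw [h519]; linarith
  have ht0one : 1 ≤ ℓ ^ 519 := one_le_pow₀ hℓ1
  have ht0pos : 0 < ℓ ^ 519 := by positivity
  have hτ' : |t - 2 * π * ℓ ^ 519| < ℓ ^ 405 + 2 := by rw [← ht0, ← hl1]; exact hτ
  obtain ⟨hτ1, hτ2⟩ := abs_lt.mp hτ'
  have hπl : 3 * ℓ ^ 519 ≤ π * ℓ ^ 519 := mul_le_mul_of_nonneg_right hπ3.le ht0pos.le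
  have ht5 : 5 * ℓ ^ 519 ≤ t := by linarith
  have htpos : 0 < t := by linarith
  have ht4 : 4 * (1 : ℝ) ≤ t := by linarith
  have hvt : ∀ v : ℝ, |v| ≤ 6 * α → |v| ≤ t / 2 := fun v hv => by linarith
  -- the tree's exact triple shift of `Y`
  obtain ⟨hYd, hY⟩ := Yroot_spec x.prim
  obtain ⟨η, hη, key⟩ := GammaFactor.sqrt_inv_Zfac_triple_shift x.prim hYd hY (A := 1) le_rfl
    hσ0 hσA ht4 (hvt v₁ habs1) (hvt v₂ habs2) (hvt v₃ habs3)
  rw [hsre, hsum] at key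
  -- the main term `(pt₀)^{β₃} Z(s,ψ)⁻¹ = e^{iv₃ log(pt₀)} Z(s,ψ)⁻¹`
  have hp0 : 0 < (x.p : ℝ) := Nat.cast_pos.mpr x.prime.pos
  set L0 : ℝ := Real.log ((x.p : ℝ) * t0 D) with hL0def
  set Lt : ℝ := Real.log ((x.p : ℝ) * t / (2 * π)) with hLtdef
  have hr0 : 0 < (x.p : ℝ) * t0 D := by rw [ht0]; positivity
  have hcpow : (((x.p : ℝ) * t0 D : ℝ) : ℂ) ^ ((v₃ : ℂ) * I) = cexp ((L0 : ℂ) * ((v₃ : ℂ) * I)) := by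
    rw [Complex.cpow_def_of_ne_zero (by exact_mod_cast hr0.ne'), hL0def,
      Complex.ofReal_log hr0.le]
  -- `LHS = (main term)·e^{ζ}` with `ζ = iv₃(log(pt/2π) − log(pt₀)) + η`
  set ζ : ℂ := (v₃ : ℂ) * ((Lt - L0 : ℝ) : ℂ) * I + η with hζdef
  have hexp : cexp (((2 * v₃ : ℝ) : ℂ) * (Lt : ℂ) / 2 * I) * cexp η
      = cexp ((L0 : ℂ) * ((v₃ : ℂ) * I)) * cexp ζ := by
    rw [← Complex.exp_add, ← Complex.exp_add, hζdef]
    congr 1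
    push_cast
    ring
  have hfac : (GammaFactor.Zfac x.ψ s)⁻¹ * cexp (((2 * v₃ : ℝ) : ℂ) * (Lt : ℂ) / 2 * I) * cexp η
        - cexp ((L0 : ℂ) * ((v₃ : ℂ) * I)) * (GammaFactor.Zfac x.ψ s)⁻¹
      = (cexp ((L0 : ℂ) * ((v₃ : ℂ) * I)) * (GammaFactor.Zfac x.ψ s)⁻¹) * (cexp ζ - 1) := by
    rw [mul_assoc, hexp]; ring
  -- `log(pt/2π) − log(pt₀) = log(1 + u)`, `u = (t − 2πt₀)/(2πt₀)`, `|u| ≤ (𝓛₁+2)/(2πt₀) ≤ 1/2`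
  set u : ℝ := (t - 2 * π * ℓ ^ 519) / (2 * π * ℓ ^ 519) with hudef
  have h2πt0 : 0 < 2 * π * ℓ ^ 519 := by positivity
  have hu1 : 1 + u = t / (2 * π * ℓ ^ 519) := by
    rw [hudef]; field_simp; ring
  have hLdiff : Lt - L0 = Real.log (1 + u) := by
    rw [hu1, hLtdef, hL0def, ht0, Real.log_div (by positivity) (by positivity),
      Real.log_mul hp0.ne' htpos.ne', Real.log_mul hp0.ne' ht0pos.ne',
      Real.log_div htpos.ne' h2πt0.ne', Real.log_mul (by positivity) ht0pos.ne']
    ring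
  have huabs : |u| ≤ (ℓ ^ 405 + 2) / (2 * π * ℓ ^ 519) := by
    rw [hudef, abs_div, abs_of_pos h2πt0]
    exact div_le_div_of_nonneg_right (abs_le.mpr ⟨hτ1.le, hτ2.le⟩) h2πt0.le
  have hU : (ℓ ^ 405 + 2) / (2 * π * ℓ ^ 519) ≤ 1 / 2 := by
    rw [div_le_iff₀ h2πt0]; linarith
  have hlog : |Real.log (1 + u)| ≤ 2 * ((ℓ ^ 405 + 2) / (2 * π * ℓ ^ 519)) :=
    (abs_log_one_add_le (huabs.trans hU)).trans (by linarith)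
  -- `‖η‖ ≤ 30α t₀⁻¹`
  have hαsq : 6 * α * (6 * α) ≤ 6 * α := by
    have := mul_le_mul_of_nonneg_left hα6 (by positivity : (0:ℝ) ≤ 6 * α)
    linarith
  have hterm : ∀ v : ℝ, |v| ≤ 6 * α → (2 * |v| + 4 * 1 + 10) * |v| ≤ 96 * α := by
    intro v hv
    have h0 : 0 ≤ |v| := abs_nonneg v
    have h1 : |v| * |v| ≤ 6 * α * (6 * α) := mul_le_mul hv hv h0 (by positivity)
    have h2 : (2 * |v| + 4 * 1 + 10) * |v| = 2 * (|v| * |v|) + 14 * |v| := by ring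
    rw [h2]; linarith
  have hηb : ‖η‖ ≤ 30 * α / ℓ ^ 519 := by
    have h1 : ((2 * |v₁| + 4 * 1 + 10) * |v₁| + (2 * |v₂| + 4 * 1 + 10) * |v₂|
        + (2 * |v₃| + 4 * 1 + 10) * |v₃|) / (2 * t) ≤ 288 * α / (2 * t) :=
      div_le_div_of_nonneg_right
        (by linarith [hterm v₁ habs1, hterm v₂ habs2, hterm v₃ habs3]) (by positivity)
    have h2 : 288 * α / (2 * t) ≤ 30 * α / ℓ ^ 519 := by
      rw [div_le_div_iff₀ (by positivity) ht0pos]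
      have := mul_le_mul_of_nonneg_left ht5 hα0.le
      have h0 : 0 ≤ α * ℓ ^ 519 := by positivity
      linarith
    exact (hη.trans h1).trans h2
  -- `‖ζ‖ ≤ 36α𝓛₁t₀⁻¹ = 36π𝓛⁻¹²³ ≤ 120𝓛⁻¹²³ ≤ 1`
  have hE : α * ℓ ^ 405 / ℓ ^ 519 = π / ℓ ^ 123 := by
    rw [hα]; field_simp
  have h123 : 0 < ℓ ^ 123 := by positivity
  have hζb : ‖ζ‖ ≤ 120 / ℓ ^ 123 := by
    have h1 : ‖(v₃ : ℂ) * ((Lt - L0 : ℝ) : ℂ) * I‖ = |v₃| * |Lt - L0| := by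
      rw [norm_mul, norm_mul, Complex.norm_real, Complex.norm_real, Complex.norm_I, mul_one,
        Real.norm_eq_abs, Real.norm_eq_abs]
    have h2 : |v₃| * |Lt - L0| ≤ 6 * α * (2 * ((ℓ ^ 405 + 2) / (2 * π * ℓ ^ 519))) := by
      rw [hLdiff]
      exact mul_le_mul habs3 hlog (abs_nonneg _) (by positivity)
    have h3 : 6 * α * (2 * ((ℓ ^ 405 + 2) / (2 * π * ℓ ^ 519))) ≤ 6 * (α * ℓ ^ 405 / ℓ ^ 519) := by
      have hq : (ℓ ^ 405 + 2) / π ≤ ℓ ^ 405 := by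
        rw [div_le_iff₀ hπ0]
        have := mul_le_mul_of_nonneg_left hπ3.le (le_trans zero_le_one h405)
        linarith
      have hr : 6 * α * (2 * ((ℓ ^ 405 + 2) / (2 * π * ℓ ^ 519)))
          = (6 * α / ℓ ^ 519) * ((ℓ ^ 405 + 2) / π) := by
        field_simp
      rw [hr, show 6 * (α * ℓ ^ 405 / ℓ ^ 519) = (6 * α / ℓ ^ 519) * ℓ ^ 405 by ring]
      exact mul_le_mul_of_nonneg_left hq (by positivity)
    have h4 : 30 * α / ℓ ^ 519 ≤ 30 * (α * ℓ ^ 405 / ℓ ^ 519) := by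
      rw [show 30 * (α * ℓ ^ 405 / ℓ ^ 519) = 30 * α * ℓ ^ 405 / ℓ ^ 519 by ring]
      refine div_le_div_of_nonneg_right ?_ ht0pos.le
      have := mul_le_mul_of_nonneg_left h405 (by positivity : (0:ℝ) ≤ 30 * α)
      linarith
    calc ‖ζ‖ ≤ ‖(v₃ : ℂ) * ((Lt - L0 : ℝ) : ℂ) * I‖ + ‖η‖ := norm_add_le _ _
      _ ≤ 6 * (α * ℓ ^ 405 / ℓ ^ 519) + 30 * (α * ℓ ^ 405 / ℓ ^ 519) := by
          rw [h1]; exact add_le_add (h2.trans h3) (hηb.trans h4)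
      _ = 36 * π / ℓ ^ 123 := by rw [hE]; ring
      _ ≤ 120 / ℓ ^ 123 :=
          div_le_div_of_nonneg_right (by linarith [Real.pi_lt_d2]) h123.le
  have hℓ123 : (120 : ℝ) ≤ ℓ ^ 123 := by
    have h5 : (3 : ℝ) ^ 5 ≤ ℓ ^ 5 := pow_le_pow_left₀ (by norm_num) hℓ3 5
    have h5' : ℓ ^ 5 ≤ ℓ ^ 123 := pow_le_pow_right₀ hℓ1 (by norm_num)
    norm_num at h5
    linarith
  have hζ1 : ‖ζ‖ ≤ 1 := hζb.trans (by rw [div_le_one h123]; exact hℓ123)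
  have hexp1 : ‖cexp ζ - 1‖ ≤ 240 * (ℓ ^ 123)⁻¹ := by
    refine (Complex.norm_exp_sub_one_le hζ1).trans ?_
    rw [← div_eq_mul_inv]
    calc 2 * ‖ζ‖ ≤ 2 * (120 / ℓ ^ 123) := by gcongr
      _ = 240 / ℓ ^ 123 := by ring
  -- assemble
  rw [hb1, hb2, hb3, key, hcpow, hfac, norm_mul]
  have hM : 0 ≤ ‖cexp ((L0 : ℂ) * ((v₃ : ℂ) * I)) * (GammaFactor.Zfac x.ψ s)⁻¹‖ := norm_nonneg _
  calc ‖cexp ((L0 : ℂ) * ((v₃ : ℂ) * I)) * (GammaFactor.Zfac x.ψ s)⁻¹‖ * ‖cexp ζ - 1‖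
      ≤ ‖cexp ((L0 : ℂ) * ((v₃ : ℂ) * I)) * (GammaFactor.Zfac x.ψ s)⁻¹‖ * (240 * (ℓ ^ 123)⁻¹) :=
        mul_le_mul_of_nonneg_left hexp1 hM
    _ = 240 * (ℓ ^ 123)⁻¹ * ‖cexp ((L0 : ℂ) * ((v₃ : ℂ) * I)) * (GammaFactor.Zfac x.ψ s)⁻¹‖ := by
        ring

end Literature.NumberTheory.LFunctions.Zhang2022.Skeleton

end
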